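import Literature.MathematicalPhysics.QuantumManyBody.TorusFockLayer

/-!
# Periodic block modes, their torus shifts, and big blocks as super-blocks
(route `BlockLatticeFSum`; decomp-a2c lens-6 g22)

Def-free pointwise identities for the one-body block modes of the route, with block index read
PERIODICALLY (`⌊K yⱼ/L⌋ mod K`): agreement with the route's block mode on the cell, `Lℤ³`-periodicity,
the shift law under `y ↦ y − (L/K)·τ₀` (`τ₀ ∈ {0,1}³`), and the identification ON THE CELL of the
side-`2L/K` block mode of corner `2S` (the `K/2`-tiling of `BlockCondensation`) with the super-block
mode `(1/√8)·Σ_τ u_(2S+τ)`. Mathlib + `TorusFockLayer` only; no definitions; no `sorry`.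
-/

namespace Summit.AtomisticToContinuum.BoseEinsteinCondensation.Theses.BlockLatticeFSum.Shift

open scoped BigOperators
open Literature.MathematicalPhysics.QuantumManyBody.BoseGas

variable {L : ℝ} {K : ℕ}

set_option linter.deprecated false

/-- `((τ • 1 : Fin K) : ℕ) = τ` for `τ ∈ {0,1}` and `2 ≤ K`. -/
theorem val_smul_one [NeZero K] (hK : 2 ≤ K) (τ : Fin 2) :
    ((((τ : ℕ) • (1 : Fin K)) : Fin K) : ℕ) = (τ : ℕ) := by
  rcases (show (τ : ℕ) = 0 ∨ (τ : ℕ) = 1 by have := τ.isLt; omega) with h | h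
  · rw [h, zero_nsmul, Fin.val_zero]
  · rw [h, one_nsmul, Fin.val_one', Nat.mod_eq_of_lt (by omega)]

/-- Value of a corner-plus-offset index when it does not wrap. -/
theorem val_add_smul_one [NeZero K] (hK : 2 ≤ K) (c : Fin K) (τ : Fin 2) (h : (c : ℕ) + (τ : ℕ) < K) :
    (((c + (τ : ℕ) • (1 : Fin K)) : Fin K) : ℕ) = (c : ℕ) + (τ : ℕ) := by
  rw [Fin.val_add, val_smul_one hK, Nat.mod_eq_of_lt h]

/-- On the cell the block index `⌊K yⱼ/L⌋` lies in `[0, K)`. -/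
theorem floor_mem (hL : 0 < L) (hK : 0 < K) {y : Space} (hy : y ∈ cell L) (j : Fin 3) :
    0 ≤ ⌊(K : ℝ) * y j / L⌋ ∧ ⌊(K : ℝ) * y j / L⌋ < (K : ℤ) := by
  have h0 : 0 ≤ y j := (hy j).1
  have h1 : y j < L := (hy j).2
  have hKr : (0 : ℝ) < K := by exact_mod_cast hK
  constructor
  · exact Int.floor_nonneg.mpr (div_nonneg (mul_nonneg hKr.le h0) hL.le)
  · rw [Int.floor_lt]
    rw [div_lt_iff₀ hL]
    push_cast
    nlinarith

/-- (i) On the cell, the PERIODIC block mode equals the route's block mode. -/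
theorem pblock_eq_on_cell (hL : 0 < L) (hK : 0 < K) (B : Fin 3 → Fin K) (c₀ : ℂ)
    {y : Space} (hy : y ∈ cell L) :
    (if (∀ j : Fin 3, ⌊(K : ℝ) * y j / L⌋ % (K : ℤ) = (((B j : Fin K) : ℕ) : ℤ)) then c₀ else 0)
      = (if (∀ j : Fin 3, ⌊(K : ℝ) * y j / L⌋ = (((B j : Fin K) : ℕ) : ℤ)) then c₀ else 0) := by
  have h : ∀ j : Fin 3, ⌊(K : ℝ) * y j / L⌋ % (K : ℤ) = ⌊(K : ℝ) * y j / L⌋ := fun j =>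
    Int.emod_eq_of_lt (floor_mem hL hK hy j).1 (floor_mem hL hK hy j).2
  simp only [h]

/-- (ii) The periodic block mode is `Lℤ³`-periodic. -/
theorem pblock_periodic (hL : L ≠ 0) (B : Fin 3 → Fin K) (c₀ : ℂ) (y : Space) (k : Fin 3) :
    (if (∀ j : Fin 3, ⌊(K : ℝ) * (y + EuclideanSpace.single k L) j / L⌋ % (K : ℤ)
          = (((B j : Fin K) : ℕ) : ℤ)) then c₀ else 0)
      = (if (∀ j : Fin 3, ⌊(K : ℝ) * y j / L⌋ % (K : ℤ) = (((B j : Fin K) : ℕ) : ℤ)) then c₀ else 0) := by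
  have h : ∀ j : Fin 3, ⌊(K : ℝ) * (y + EuclideanSpace.single k L) j / L⌋ % (K : ℤ)
      = ⌊(K : ℝ) * y j / L⌋ % (K : ℤ) := by
    intro j
    rw [PiLp.add_apply, EuclideanSpace.single_apply]
    split_ifs with hj
    · have : (K : ℝ) * (y j + L) / L = (K : ℝ) * y j / L + (K : ℕ) := by
        field_simp
      rw [this, Int.floor_add_natCast]
      exact Int.add_emod_right _ _
    · rw [add_zero]
  simp only [h]

/-- (iii) SHIFT LAW: translating the periodic block mode by `−(L/K)·τ₀` shifts its index by `+τ₀`. -/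
theorem pblock_shift [NeZero K] (hL : L ≠ 0) (hK : 2 ≤ K) (B : Fin 3 → Fin K) (τ₀ : Fin 3 → Fin 2) (c₀ : ℂ)
    (y : Space) :
    (if (∀ j : Fin 3, ⌊(K : ℝ) * (y + ∑ k : Fin 3,
          EuclideanSpace.single k (-(((τ₀ k : ℕ) : ℝ) * (L / (K : ℝ))))) j / L⌋ % (K : ℤ)
            = (((B j : Fin K) : ℕ) : ℤ)) then c₀ else 0)
      = (if (∀ j : Fin 3, ⌊(K : ℝ) * y j / L⌋ % (K : ℤ)
            = ((((B + fun i : Fin 3 => ((τ₀ i : ℕ) • (1 : Fin K))) j : Fin K) : ℕ) : ℤ)) then c₀ else 0) := by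
  have hKr : (K : ℝ) ≠ 0 := by exact_mod_cast (show K ≠ 0 by omega)
  have hKz : (0 : ℤ) < (K : ℤ) := by exact_mod_cast (show 0 < K by omega)
  have hcoord : ∀ j : Fin 3,
      (y + ∑ k : Fin 3, EuclideanSpace.single k (-(((τ₀ k : ℕ) : ℝ) * (L / (K : ℝ))))) j
        = y j + -(((τ₀ j : ℕ) : ℝ) * (L / (K : ℝ))) := by
    intro j
    rw [PiLp.add_apply, WithLp.ofLp_sum]
    simp [Finset.sum_apply]
  have h : ∀ j : Fin 3,
      (⌊(K : ℝ) * (y + ∑ k : Fin 3, EuclideanSpace.single k (-(((τ₀ k : ℕ) : ℝ) * (L / (K : ℝ))))) j / L⌋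
          % (K : ℤ) = (((B j : Fin K) : ℕ) : ℤ))
        ↔ (⌊(K : ℝ) * y j / L⌋ % (K : ℤ)
          = ((((B + fun i : Fin 3 => ((τ₀ i : ℕ) • (1 : Fin K))) j : Fin K) : ℕ) : ℤ)) := by
    intro j
    rw [hcoord j]
    have e1 : (K : ℝ) * (y j + -(((τ₀ j : ℕ) : ℝ) * (L / (K : ℝ)))) / L
        = (K : ℝ) * y j / L + ((-((τ₀ j : ℕ) : ℤ) : ℤ) : ℝ) := by
      push_cast
      field_simp
    rw [e1, Int.floor_add_intCast]
    have e2 : ((((B + fun i : Fin 3 => ((τ₀ i : ℕ) • (1 : Fin K))) j : Fin K) : ℕ) : ℤ)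
        = ((((B j : Fin K) : ℕ) : ℤ) + ((τ₀ j : ℕ) : ℤ)) % (K : ℤ) := by
      rw [Pi.add_apply, Fin.val_add, val_smul_one hK (τ₀ j)]
      push_cast
      rfl
    rw [e2]
    have hB : (((B j : Fin K) : ℕ) : ℤ) = (((B j : Fin K) : ℕ) : ℤ) % (K : ℤ) :=
      (Int.emod_eq_of_lt (by positivity) (by exact_mod_cast (B j).isLt)).symm
    set b : ℤ := ⌊(K : ℝ) * y j / L⌋
    constructor
    · intro hh
      rw [hB] at hh
      rw [Int.emod_eq_emod_iff_emod_sub_eq_zero] at hh ⊢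
      have : b - ((((B j : Fin K) : ℕ) : ℤ) + ((τ₀ j : ℕ) : ℤ)) = b + -((τ₀ j : ℕ) : ℤ) - (((B j : Fin K) : ℕ) : ℤ) := by
        ring
      rw [this]; exact hh
    · intro hh
      rw [hB]
      rw [Int.emod_eq_emod_iff_emod_sub_eq_zero] at hh ⊢
      have : b + -((τ₀ j : ℕ) : ℤ) - (((B j : Fin K) : ℕ) : ℤ) = b - ((((B j : Fin K) : ℕ) : ℤ) + ((τ₀ j : ℕ) : ℤ)) := by
        ring
      rw [this]; exact hh
  simp only [h]

/-- Window arithmetic: on the cell, `⌊K' yⱼ/L⌋ = S` iff `⌊K yⱼ/L⌋ ∈ {2S, 2S+1}` (`K = 2K'`). -/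
theorem floor_half_iff {K' : ℕ} (hKK : K = 2 * K') (r : ℝ) (S : ℤ) :
    ⌊(K' : ℝ) * r⌋ = S ↔ (⌊(K : ℝ) * r⌋ = 2 * S ∨ ⌊(K : ℝ) * r⌋ = 2 * S + 1) := by
  have hK : (K : ℝ) * r = 2 * ((K' : ℝ) * r) := by
    rw [hKK]; push_cast; ring
  rw [hK]
  set s : ℝ := (K' : ℝ) * r
  constructor
  · intro h
    rw [Int.floor_eq_iff] at h
    rcases lt_or_ge s ((S : ℝ) + 1 / 2) with h2 | h2
    · left
      rw [Int.floor_eq_iff]; push_cast; constructor <;> linarith [h.1, h.2]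
    · right
      rw [Int.floor_eq_iff]; push_cast; constructor <;> linarith [h.1, h.2]
  · rintro (h | h) <;> rw [Int.floor_eq_iff] at h ⊢ <;> push_cast at h ⊢ <;>
      constructor <;> linarith [h.1, h.2]

/-- (iv) BIG BLOCK = SUPER-BLOCK on the cell: the side-`L/K'` block mode of index `S`
(`K = 2K'`) equals `(1/√8)·Σ_τ` (periodic block mode of index `2S + τ`). -/
theorem bigblock_eq_on_cell [NeZero K] (hL : 0 < L) {K' : ℕ} (hKK : K = 2 * K') (hK : 2 ≤ K)
    (S : Fin 3 → Fin K') {y : Space} (hy : y ∈ cell L) :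
    (if (∀ j : Fin 3, ⌊(K' : ℝ) * y j / L⌋ = (((S j : Fin K') : ℕ) : ℤ))
        then ((((Real.sqrt ((L / (K' : ℝ)) ^ 3))⁻¹ : ℝ) : ℂ)) else 0)
      = ∑ τ : Fin 3 → Fin 2, (((Real.sqrt 8)⁻¹ : ℝ) : ℂ) *
          (if (∀ i : Fin 3, ⌊(K : ℝ) * y i / L⌋ % (K : ℤ)
              = (((((fun j : Fin 3 => (⟨2 * (S j : ℕ), by omega⟩ : Fin K))
                    + fun i : Fin 3 => ((τ i : ℕ) • (1 : Fin K))) i : Fin K) : ℕ) : ℤ))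
            then ((((Real.sqrt ((L / (K : ℝ)) ^ 3))⁻¹ : ℝ) : ℂ)) else 0) := by
  have hK0 : 0 < K := by omega
  have hb := fun j => floor_mem hL hK0 hy j
  -- values of the corner indices
  have hval : ∀ (τ : Fin 3 → Fin 2) (i : Fin 3),
      (((((fun j : Fin 3 => (⟨2 * (S j : ℕ), by omega⟩ : Fin K))
          + fun i : Fin 3 => ((τ i : ℕ) • (1 : Fin K))) i : Fin K) : ℕ) : ℤ)
        = 2 * (((S i : Fin K') : ℕ) : ℤ) + ((τ i : ℕ) : ℤ) := by
    intro τ i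
    rw [Pi.add_apply, val_add_smul_one hK _ (τ i)
      (by have := (S i).isLt; have := (τ i).isLt; simp only; omega)]
    push_cast
    ring
  have hmod : ∀ i : Fin 3, ⌊(K : ℝ) * y i / L⌋ % (K : ℤ) = ⌊(K : ℝ) * y i / L⌋ := fun i =>
    Int.emod_eq_of_lt (hb i).1 (hb i).2
  simp only [hval, hmod]
  -- the window arithmetic, per coordinate
  have hwin : ∀ j : Fin 3, (⌊(K' : ℝ) * y j / L⌋ = (((S j : Fin K') : ℕ) : ℤ))
      ↔ (⌊(K : ℝ) * y j / L⌋ = 2 * (((S j : Fin K') : ℕ) : ℤ)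
          ∨ ⌊(K : ℝ) * y j / L⌋ = 2 * (((S j : Fin K') : ℕ) : ℤ) + 1) := by
    intro j
    have := floor_half_iff (K := K) hKK (y j / L) (((S j : Fin K') : ℕ) : ℤ)
    rwa [← mul_div_assoc, ← mul_div_assoc] at this
  -- the constants
  have hconst : ((((Real.sqrt ((L / (K' : ℝ)) ^ 3))⁻¹ : ℝ) : ℂ))
      = (((Real.sqrt 8)⁻¹ : ℝ) : ℂ) * ((((Real.sqrt ((L / (K : ℝ)) ^ 3))⁻¹ : ℝ) : ℂ)) := by
    rw [← Complex.ofReal_mul]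
    congr 1
    have hK'r : (0 : ℝ) < K' := by exact_mod_cast (show 0 < K' by omega)
    have hKr : (K : ℝ) = 2 * K' := by rw [hKK]; push_cast; ring
    have h1 : L / (K' : ℝ) = 2 * (L / (K : ℝ)) := by rw [hKr]; field_simp
    rw [h1, mul_pow, show (2 : ℝ) ^ 3 = 8 by norm_num,
      Real.sqrt_mul (by norm_num : (0 : ℝ) ≤ 8), mul_inv]
  by_cases hA : ∀ j : Fin 3, (⌊(K : ℝ) * y j / L⌋ = 2 * (((S j : Fin K') : ℕ) : ℤ)
      ∨ ⌊(K : ℝ) * y j / L⌋ = 2 * (((S j : Fin K') : ℕ) : ℤ) + 1)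
  · -- Case A: `y` lies in the big block; exactly one `τ` matches
    have hL1 : ∀ j : Fin 3, ⌊(K' : ℝ) * y j / L⌋ = (((S j : Fin K') : ℕ) : ℤ) := fun j => (hwin j).2 (hA j)
    rw [if_pos hL1]
    let τs : Fin 3 → Fin 2 := fun j => if ⌊(K : ℝ) * y j / L⌋ = 2 * (((S j : Fin K') : ℕ) : ℤ) then 0 else 1
    have hτs : ∀ j : Fin 3, ⌊(K : ℝ) * y j / L⌋ = 2 * (((S j : Fin K') : ℕ) : ℤ) + ((τs j : ℕ) : ℤ) := by
      intro j
      rcases hA j with h | h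
      · simp [τs, h]
      · have hne : ¬ (⌊(K : ℝ) * y j / L⌋ = 2 * (((S j : Fin K') : ℕ) : ℤ)) := by rw [h]; omega
        simp [τs, h]
    rw [Finset.sum_eq_single τs]
    · rw [if_pos (fun i => hτs i), hconst]
    · intro τ _ hne
      have : ¬ (∀ i : Fin 3, ⌊(K : ℝ) * y i / L⌋ = 2 * (((S i : Fin K') : ℕ) : ℤ) + ((τ i : ℕ) : ℤ)) := by
        intro hall
        apply hne
        funext i
        have h1 := hall i
        rw [hτs i] at h1
        have h2 : ((τ i : ℕ) : ℤ) = ((τs i : ℕ) : ℤ) := by linarith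
        exact Fin.ext (by exact_mod_cast h2.symm) |>.symm
      rw [if_neg this, mul_zero]
    · intro h; exact absurd (Finset.mem_univ τs) h
  · -- Case B: outside the big block everything vanishes
    have hL0 : ¬ (∀ j : Fin 3, ⌊(K' : ℝ) * y j / L⌋ = (((S j : Fin K') : ℕ) : ℤ)) := by
      intro hall; exact hA (fun j => (hwin j).1 (hall j))
    rw [if_neg hL0]
    symm
    refine Finset.sum_eq_zero (fun τ _ => ?_)
    have : ¬ (∀ i : Fin 3, ⌊(K : ℝ) * y i / L⌋ = 2 * (((S i : Fin K') : ℕ) : ℤ) + ((τ i : ℕ) : ℤ)) := by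
      intro hall
      apply hA
      intro j
      rcases (show (τ j : ℕ) = 0 ∨ (τ j : ℕ) = 1 by have := (τ j).isLt; omega) with h | h
      · left; have := hall j; rw [h] at this; push_cast at this; linarith
      · right; have := hall j; rw [h] at this; push_cast at this; linarith
    rw [if_neg this, mul_zero]

/-- (v-b) The super-block sum of periodic block modes is `Lℤ³`-periodic. -/
theorem psuper_periodic [NeZero K] (hL : L ≠ 0) (c : Fin 3 → Fin K) (c₀ : ℂ) (y : Space) (k : Fin 3) :
    (∑ τ : Fin 3 → Fin 2, (((Real.sqrt 8)⁻¹ : ℝ) : ℂ) *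
        (if (∀ i : Fin 3, ⌊(K : ℝ) * (y + EuclideanSpace.single k L) i / L⌋ % (K : ℤ)
            = ((((c + fun i : Fin 3 => ((τ i : ℕ) • (1 : Fin K))) i : Fin K) : ℕ) : ℤ))
          then c₀ else 0))
      = ∑ τ : Fin 3 → Fin 2, (((Real.sqrt 8)⁻¹ : ℝ) : ℂ) *
        (if (∀ i : Fin 3, ⌊(K : ℝ) * y i / L⌋ % (K : ℤ)
            = ((((c + fun i : Fin 3 => ((τ i : ℕ) • (1 : Fin K))) i : Fin K) : ℕ) : ℤ))
          then c₀ else 0) := by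
  refine Finset.sum_congr rfl (fun τ _ => ?_)
  rw [pblock_periodic hL]

/-- (v-c) SHIFT LAW for the super-block sum: translating by `−(L/K)·τ₀` moves the corner by `+τ₀`. -/
theorem psuper_shift [NeZero K] (hL : L ≠ 0) (hK : 2 ≤ K) (c : Fin 3 → Fin K) (τ₀ : Fin 3 → Fin 2)
    (c₀ : ℂ) (y : Space) :
    (∑ τ : Fin 3 → Fin 2, (((Real.sqrt 8)⁻¹ : ℝ) : ℂ) *
        (if (∀ i : Fin 3, ⌊(K : ℝ) * (y + ∑ k : Fin 3,
            EuclideanSpace.single k (-(((τ₀ k : ℕ) : ℝ) * (L / (K : ℝ))))) i / L⌋ % (K : ℤ)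
            = ((((c + fun i : Fin 3 => ((τ i : ℕ) • (1 : Fin K))) i : Fin K) : ℕ) : ℤ))
          then c₀ else 0))
      = ∑ τ : Fin 3 → Fin 2, (((Real.sqrt 8)⁻¹ : ℝ) : ℂ) *
        (if (∀ i : Fin 3, ⌊(K : ℝ) * y i / L⌋ % (K : ℤ)
            = (((((c + fun i : Fin 3 => ((τ₀ i : ℕ) • (1 : Fin K)))
                + fun i : Fin 3 => ((τ i : ℕ) • (1 : Fin K))) i : Fin K) : ℕ) : ℤ))
          then c₀ else 0) := by
  refine Finset.sum_congr rfl (fun τ _ => ?_)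
  rw [pblock_shift hL hK, add_right_comm]

/-- (v-d) On the cell the periodic super-block sum is the route's super-block mode `U_c`. -/
theorem psuper_eq_on_cell [NeZero K] (hL : 0 < L) (hK : 0 < K) (c : Fin 3 → Fin K) (c₀ : ℂ)
    {y : Space} (hy : y ∈ cell L) :
    (∑ τ : Fin 3 → Fin 2, (((Real.sqrt 8)⁻¹ : ℝ) : ℂ) *
        (if (∀ i : Fin 3, ⌊(K : ℝ) * y i / L⌋ % (K : ℤ)
            = ((((c + fun i : Fin 3 => ((τ i : ℕ) • (1 : Fin K))) i : Fin K) : ℕ) : ℤ))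
          then c₀ else 0))
      = ∑ τ : Fin 3 → Fin 2, (((Real.sqrt 8)⁻¹ : ℝ) : ℂ) *
        (if (∀ i : Fin 3, ⌊(K : ℝ) * y i / L⌋
            = ((((c + fun i : Fin 3 => ((τ i : ℕ) • (1 : Fin K))) i : Fin K) : ℕ) : ℤ))
          then c₀ else 0) := by
  refine Finset.sum_congr rfl (fun τ _ => ?_)
  rw [pblock_eq_on_cell hL hK _ _ hy]

/-- (vi) The corners `2S + τ₀` (`S ∈ (Fin K')³`, `τ₀ ∈ {0,1}³`, `K = 2K'`) are pairwise distinct, so a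
sum of nonnegative terms over them is at most the sum over ALL corners. -/
theorem sum_corners_le [NeZero K] {K' : ℕ} (hKK : K = 2 * K') (hK : 2 ≤ K)
    (g : (Fin 3 → Fin K) → ENNReal) :
    ∑ τ₀ : Fin 3 → Fin 2, ∑ S : Fin 3 → Fin K',
        g ((fun j : Fin 3 => (⟨2 * (S j : ℕ), by omega⟩ : Fin K))
            + fun i : Fin 3 => ((τ₀ i : ℕ) • (1 : Fin K)))
      ≤ ∑ c : Fin 3 → Fin K, g c := by
  classical
  let F : (Fin 3 → Fin 2) × (Fin 3 → Fin K') → (Fin 3 → Fin K) := fun p =>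
    (fun j : Fin 3 => (⟨2 * (p.2 j : ℕ), by omega⟩ : Fin K)) + fun i : Fin 3 => ((p.1 i : ℕ) • (1 : Fin K))
  have hF : ∀ p i, ((F p i : Fin K) : ℕ) = 2 * (p.2 i : ℕ) + (p.1 i : ℕ) := by
    intro p i
    simp only [F, Pi.add_apply]
    rw [val_add_smul_one hK _ (p.1 i)
      (by have := (p.2 i).isLt; have := (p.1 i).isLt; simp only; omega)]
  have hinj : Function.Injective F := by
    intro p q h
    have hc : ∀ i, 2 * (p.2 i : ℕ) + (p.1 i : ℕ) = 2 * (q.2 i : ℕ) + (q.1 i : ℕ) := by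
      intro i; rw [← hF p i, ← hF q i, h]
    refine Prod.ext (funext fun i => Fin.ext ?_) (funext fun i => Fin.ext ?_)
    · have := hc i; have := (p.1 i).isLt; have := (q.1 i).isLt; omega
    · have := hc i; have := (p.1 i).isLt; have := (q.1 i).isLt; omega
  calc ∑ τ₀ : Fin 3 → Fin 2, ∑ S : Fin 3 → Fin K',
          g ((fun j : Fin 3 => (⟨2 * (S j : ℕ), by omega⟩ : Fin K))
            + fun i : Fin 3 => ((τ₀ i : ℕ) • (1 : Fin K)))
        = ∑ p ∈ (Finset.univ : Finset (Fin 3 → Fin 2)) ×ˢ (Finset.univ : Finset (Fin 3 → Fin K')),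
            g (F p) := by
          rw [Finset.sum_product]
    _ = ∑ c ∈ ((Finset.univ : Finset (Fin 3 → Fin 2)) ×ˢ (Finset.univ : Finset (Fin 3 → Fin K'))).image F,
            g c := by
          rw [Finset.sum_image (fun p _ q _ h => hinj h)]
    _ ≤ ∑ c : Fin 3 → Fin K, g c :=
          Finset.sum_le_sum_of_subset_of_nonneg (Finset.subset_univ _) (fun _ _ _ => zero_le')

end Summit.AtomisticToContinuum.BoseEinsteinCondensation.Theses.BlockLatticeFSum.Shift
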